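import Literature.Geometry.Lorentzian.GlobalHyperbolicityStrongCausalityProofs
import Literature.Geometry.Lorentzian.NonImprisonmentProofs
import Literature.Geometry.Lorentzian.CausalityConditionsProofs
import Literature.Geometry.Lorentzian.GeodesicRayEndless
import Literature.Geometry.Lorentzian.GeodesicSpeed
import Literature.Geometry.Lorentzian.TrappedZeroEnergyRay
import Literature.Geometry.Lorentzian.LeviCivitaProofs
import HarnessLib

/-!
# Null geodesic rays are not imprisoned in compact sets of globally hyperbolic spacetimes

For a spacetime `𝓢` (connected, Hausdorff, second countable `C^∞` Lorentzian `d`-manifold with a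
time orientation) whose metric is globally hyperbolic in the Bernal–Sánchez sense
(`LorentzianMetric.IsGloballyHyperbolic`: causal + compact causal diamonds) we prove, FACT-FREE:

* `Spacetime.exists_forall_notMem_of_isGeodesicOn_of_isNull` — an affinely parametrised geodesic
  ray `γ|[0,∞)` of the Levi-Civita connection with null velocity eventually leaves every compact set
  `K`, never to return (`∃ s₀ ≥ 0, ∀ s ≥ s₀, γ s ∉ K`);
* `Spacetime.not_subset_of_isGeodesicOn_of_isNull` — in particular it is not contained in `K`.

This is the classical chain "globally hyperbolic ⇒ strongly causal (Bernal–Sánchez 2007, Thm. 3.2)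
⇒ no future-endless causal curve is (partially) imprisoned in a compact set (O'Neill 1983, Ch. 14,
Lemma 13; Hawking–Ellis 1973, Prop. 6.4.7)", all three links being theorems of the tree
(`bernalSanchez_isStronglyCausal_of_isGloballyHyperbolic_holds`,
`IsStronglyCausal.exists_forall_notMem_of_isCompact_holds`, and — the point where affinely
parametrised COMPLETE rays enter causality theory — `IsGeodesicOn.isFutureEndless_Ici_of_velocity_ne_zero`
of `GeodesicRayEndless.lean`: a geodesic ray with nowhere-zero velocity has no future endpoint),
applied to `γ` read as a future causal curve for `τ` or for `-τ`: the sign of `g(T, γ')` (with `T`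
the orienting field) cannot change along the ray, a causal vector being never orthogonal to a
timelike one (O'Neill 1983, Ch. 5, Lemma 26), and global hyperbolicity is time-symmetric
(`LorentzianMetric.IsGloballyHyperbolic.reverse`).

It is the fact-free, summit-independent form of
`Summits/FinalStateConjecture/…/Theorems/ErgoregionBomb/Negative/TrappingClauseVacuous.lean`
(`trapping_clause_contradictory`, which took the three links as hypotheses), whose proof is followed.

## References

* A. N. Bernal, M. Sánchez, Class. Quantum Grav. 24 (2007) 745–749, Thm. 3.2. Key `BernalSanchez2007CQG`.
* B. O'Neill, *Semi-Riemannian geometry with applications to relativity*, Academic Press 1983,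
  Ch. 5, Lemma 26; Ch. 14, Lemma 13 (p. 407). Key `ONeillSemiRiemannian1983`.
* S. W. Hawking, G. F. R. Ellis, *The large scale structure of space-time*, CUP 1973, §6.4,
  Prop. 6.4.7 (p. 195). Key `HawkingEllis1973CUP`.
-/

noncomputable section

open Bundle Set Filter
open scoped Manifold ContDiff Topology

namespace Literature.Geometry.Lorentzian

/-! ### Global hyperbolicity is time-symmetric -/

section Reverse

variable {E : Type*} [NormedAddCommGroup E] [NormedSpace ℝ E] {H : Type*} [TopologicalSpace H]
  {I : ModelWithCorners ℝ E H} {n : ℕ∞ω} {M : Type*} [TopologicalSpace M] [ChartedSpace H M]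
  [IsManifold I ∞ M]

/-- **Global hyperbolicity is invariant under time reversal**: the causality condition is
(`IsCausallyWellBehaved.reverse`) and the causal diamonds of `-τ` are those of `τ` with `p, q`
swapped (`causalPast_reverse`). O'Neill 1983, Ch. 14, p. 402 (time duality) and p. 412.
[cite: ONeillSemiRiemannian1983, Ch. 14, p. 402 (time duality)] -/
theorem LorentzianMetric.IsGloballyHyperbolic.reverse {g : LorentzianMetric I n M}
    {τ : TimeOrientation g} (h : g.IsGloballyHyperbolic τ) : g.IsGloballyHyperbolic τ.reverse := by
  refine ⟨h.1.reverse, fun p q ↦ ?_⟩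
  have e1 : g.causalFuture τ.reverse {p} = g.causalPast τ {p} := rfl
  rw [e1, LorentzianMetric.causalPast_reverse, Set.inter_comm]
  exact h.2 q p

end Reverse

/-! ### Non-imprisonment of null geodesic rays -/

namespace Spacetime

variable {d : ℕ} (𝓢 : Spacetime d) [𝓢.metric.HasLeviCivita]

/-- `2 ≤ ∞` in `ℕ∞ω` (regularity side condition of the causality theorems). [folklore] -/
private lemma two_le_infty' : (2 : ℕ∞ω) ≤ ∞ := WithTop.coe_le_coe.mpr le_top

/-- **A null geodesic ray in a globally hyperbolic spacetime eventually leaves every compact set,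
never to return.**  For `𝓢` globally hyperbolic, `γ` an affinely parametrised geodesic of the
Levi-Civita connection on `[0, ∞)` with null velocity there, and `K` compact: there is `s₀ ≥ 0`
with `γ s ∉ K` for all `s ≥ s₀`.  Chain: the ray is future endless
(`IsGeodesicOn.isFutureEndless_Ici_of_velocity_ne_zero`; a null vector is non-zero), it is a
future causal curve for `τ` or for `-τ` (the continuous function `g(T, γ')` never vanishes —
O'Neill 1983, Ch. 5, Lemma 26 — so it has constant sign by the intermediate value theorem),
global hyperbolicity (of `τ`, resp. of `-τ` by `IsGloballyHyperbolic.reverse`) gives strong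
causality (Bernal–Sánchez 2007, Thm. 3.2), and strong causality forbids partial imprisonment of a
future-endless causal curve in a compact set (O'Neill 1983, Ch. 14, Lemma 13; Hawking–Ellis 1973,
Prop. 6.4.7). [cite: ONeillSemiRiemannian1983, Ch. 14, Lemma 13 (p. 407)] -/
theorem exists_forall_notMem_of_isGeodesicOn_of_isNull
    (hgh : 𝓢.metric.IsGloballyHyperbolic 𝓢.timeOrientation)
    {γ : ℝ → 𝓢.carrier} (hg : IsGeodesicOn 𝓢.metric.leviCivita γ (Set.Ici 0))
    (hnull : ∀ s : ℝ, 0 ≤ s → 𝓢.metric.IsNull (velocity (𝓡 d) γ s))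
    {K : Set 𝓢.carrier} (hK : IsCompact K) :
    ∃ s₀ : ℝ, 0 ≤ s₀ ∧ ∀ s : ℝ, s₀ ≤ s → γ s ∉ K := by
  haveI : CovariantDerivative.ContMDiffCovariantDerivative 𝓢.metric.leviCivita 1 :=
    ⟨𝓢.metric.isLocallyContMDiff_leviCivita_holds 1
      (by rw [show ((1 : ℕ∞) : ℕ∞ω) + 1 = 2 by norm_num]; exact two_le_infty') univ isOpen_univ⟩
  set τ := 𝓢.timeOrientation with hτ
  -- the sign function `f(t) = g(T, γ')(t)`
  set f : ℝ → ℝ := fun t ↦ 𝓢.metric.val (γ t) (τ.vectorField (γ t)) (velocity (𝓡 d) γ t)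
    with hf
  have hcov : 𝓢.metric.toPseudoRiemannianMetric.IsCompatible 𝓢.metric.leviCivita :=
    (PseudoRiemannianMetric.isLeviCivita_leviCivita_holds
      (g := 𝓢.metric.toPseudoRiemannianMetric)).2
  have hmd : ∀ t ∈ Set.Ici (0 : ℝ), MDifferentiableAt 𝓘(ℝ, ℝ) (𝓡 d) γ t := fun t ht ↦
    IsGeodesicOn.mdifferentiableAt_holds hg ht
  have hderiv : ∀ t ∈ Set.Ici (0 : ℝ), ∃ f', HasDerivAt f f' t := by
    intro t ht
    have hXd : MDifferentiableAt (𝓡 d) (𝓡 d).tangent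
        (fun x ↦ (TotalSpace.mk' (EuclideanSpace ℝ (Fin d)) x (τ.vectorField x) :
          TangentBundle (𝓡 d) 𝓢.carrier)) (γ t) :=
      (τ.contMDiff (γ t)).mdifferentiableAt (by simp)
    exact ⟨_, 𝓢.metric.toPseudoRiemannianMetric.hasDerivAt_val_apply_along hcov
      (V := fun t ↦ τ.vectorField (γ t)) (W := fun t ↦ velocity (𝓡 d) γ t)
      (mdifferentiableAt_lift_comp hXd (hmd t ht)) (hg.1 t ht)⟩
  have hcont : ContinuousOn f (Set.Ici 0) := fun t ht ↦ by
    obtain ⟨f', h⟩ := hderiv t ht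
    exact h.continuousAt.continuousWithinAt
  have hne : ∀ t ∈ Set.Ici (0 : ℝ), f t ≠ 0 := fun t ht ↦
    𝓢.metric.val_ne_zero_of_isTimelike_of_isCausal (τ.isTimelike _) (hnull t ht).isCausal
  -- constant sign on `[0, ∞)` (intermediate value theorem)
  have hsign : (∀ t ∈ Set.Ici (0 : ℝ), f t < 0) ∨ (∀ t ∈ Set.Ici (0 : ℝ), 0 < f t) := by
    rcases lt_or_gt_of_ne (hne 0 Set.self_mem_Ici) with h0 | h0
    · refine Or.inl fun t ht ↦ ?_
      by_contra hft
      have hft' : 0 ≤ f t := not_lt.mp hft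
      obtain ⟨s, hs, hs0⟩ := intermediate_value_Icc (show (0 : ℝ) ≤ t from ht)
        (hcont.mono Set.Icc_subset_Ici_self) ⟨h0.le, hft'⟩
      exact hne s (Set.mem_Ici.2 hs.1) hs0
    · refine Or.inr fun t ht ↦ ?_
      by_contra hft
      have hft' : f t ≤ 0 := not_lt.mp hft
      obtain ⟨s, hs, hs0⟩ := intermediate_value_Icc' (show (0 : ℝ) ≤ t from ht)
        (hcont.mono Set.Icc_subset_Ici_self) ⟨hft', h0.le⟩
      exact hne s (Set.mem_Ici.2 hs.1) hs0
  -- the ray is future endless (a null vector is non-zero)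
  have hend : IsFutureEndless γ (Set.Ici 0) :=
    hg.isFutureEndless_Ici_of_velocity_ne_zero fun s hs ↦ (hnull s hs).2
  rcases hsign with hneg | hpos
  · -- future-directed: non-imprisonment for `τ`
    have hcurve : 𝓢.metric.IsFutureCausalCurveOn τ γ (Set.Ici 0) := fun t ht ↦
      ⟨hmd t ht, (hnull t ht).isCausal, hneg t ht⟩
    have hsc : 𝓢.metric.IsStronglyCausal τ :=
      LorentzianMetric.bernalSanchez_isStronglyCausal_of_isGloballyHyperbolic_holds 𝓢.metric τ
        two_le_infty' hgh
    obtain ⟨t, ht, hout⟩ :=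
      LorentzianMetric.IsStronglyCausal.exists_forall_notMem_of_isCompact_holds two_le_infty'
        hsc hK Set.ordConnected_Ici hcurve hend
    exact ⟨t, ht, fun s hs ↦ hout s (le_trans (show (0 : ℝ) ≤ t from ht) hs) hs⟩
  · -- past-directed: non-imprisonment for `τ.reverse`
    have hcurve : 𝓢.metric.IsFutureCausalCurveOn τ.reverse γ (Set.Ici 0) := fun t ht ↦
      ⟨hmd t ht, (TimeOrientation.isFutureDirected_reverse_iff _ _).mpr
        ⟨(hnull t ht).isCausal, hpos t ht⟩⟩
    have hsc : 𝓢.metric.IsStronglyCausal τ.reverse :=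
      LorentzianMetric.bernalSanchez_isStronglyCausal_of_isGloballyHyperbolic_holds 𝓢.metric
        τ.reverse two_le_infty' hgh.reverse
    obtain ⟨t, ht, hout⟩ :=
      LorentzianMetric.IsStronglyCausal.exists_forall_notMem_of_isCompact_holds two_le_infty'
        hsc hK Set.ordConnected_Ici hcurve hend
    exact ⟨t, ht, fun s hs ↦ hout s (le_trans (show (0 : ℝ) ≤ t from ht) hs) hs⟩

/-- **A null geodesic ray in a globally hyperbolic spacetime is not contained in a compact set**
(total imprisonment is excluded; corollary of `exists_forall_notMem_of_isGeodesicOn_of_isNull`).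
In the stationary black-hole telescope this is why a "trapped zero-energy ray" in the sense of
`StationaryAFBlackHole.HasTrappedZeroEnergyRay` (`γ([0,∞)) ⊆ K` compact, in SPACETIME) never
exists on a globally hyperbolic hole — trapping must be phrased modulo the stationary flow.
O'Neill 1983, Ch. 14, Lemma 13; Hawking–Ellis 1973, Prop. 6.4.7.
[cite: HawkingEllis1973CUP, §6.4, Prop. 6.4.7 (p. 195)] -/
theorem not_forall_mem_of_isGeodesicOn_of_isNull
    (hgh : 𝓢.metric.IsGloballyHyperbolic 𝓢.timeOrientation)
    {γ : ℝ → 𝓢.carrier} (hg : IsGeodesicOn 𝓢.metric.leviCivita γ (Set.Ici 0))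
    (hnull : ∀ s : ℝ, 0 ≤ s → 𝓢.metric.IsNull (velocity (𝓡 d) γ s))
    {K : Set 𝓢.carrier} (hK : IsCompact K) : ¬ ∀ s : ℝ, 0 ≤ s → γ s ∈ K := by
  intro hin
  obtain ⟨s₀, hs₀, hout⟩ := 𝓢.exists_forall_notMem_of_isGeodesicOn_of_isNull hgh hg hnull hK
  exact hout s₀ le_rfl (hin s₀ hs₀)

end Spacetime

/-- **No trapped zero-energy ray on a globally hyperbolic stationary black hole** (fact-free):
the Literature predicate `StationaryAFBlackHole.HasTrappedZeroEnergyRay` — an affinely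
parametrised null geodesic ray with `g(T, γ') = 0` contained in a compact subset of the d.o.c. —
is unsatisfiable whenever the carrier is globally hyperbolic, since already a null geodesic ray
contained in a compact subset of spacetime is impossible
(`Spacetime.not_forall_mem_of_isGeodesicOn_of_isNull`); neither the zero-energy condition nor
`K ⊆ doc` is used.  (So the non-trapping hypothesis of the route item `ZeroEnergyRigidity` and the
trapping hypothesis of `ErgoregionBomb` of FinalStateConjecture/ZeroEnergyKerrOrBomb are, as typed,
automatic resp. void under global hyperbolicity; the intended notion is trapping modulo the
stationary flow, `StationaryAFBlackHole.HasZeroEnergyRayTrappedModFlow`.)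
[cite: HawkingEllis1973CUP, §6.4, Prop. 6.4.7 (p. 195)] -/
theorem StationaryAFBlackHole.not_hasTrappedZeroEnergyRay_of_isGloballyHyperbolic
    (𝓑 : StationaryAFBlackHole.{0}) [𝓑.metric.HasLeviCivita]
    (hgh : 𝓑.metric.IsGloballyHyperbolic 𝓑.timeOrientation) : ¬ 𝓑.HasTrappedZeroEnergyRay := by
  rintro ⟨γ, K, hg, hz, hK, -, hin⟩
  exact 𝓑.toSpacetime.not_forall_mem_of_isGeodesicOn_of_isNull hgh hg (fun s hs ↦ (hz s hs).1)
    hK hin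

end Literature.Geometry.Lorentzian

end
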